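import Literature.MathematicalPhysics.QuantumFieldTheory.Balaban1983to89.B6KLevelFamilyWitnessOddLV1
import Literature.MathematicalPhysics.QuantumFieldTheory.Balaban1983to89.Node00.N03Record

/-!
# NODE N03 · [Balaban1984PropagatorsII] — THE INDEX OF THE TOWER BLOCK OF RECORD IS INHABITED AT EVERY ODD `L ≥ 5`; INHABITED-AT-3 AT EVERY ODD `L ≥ 5`

T. Bałaban, *Propagators and renormalization transformations for lattice gauge theories. II*, Comm. Math. Phys. **96** (1984) 223–250
[Balaban1984PropagatorsII], (2.1)–(2.4) p. 224, (2.16) p. 225.  TRACK A (YM-PLAN §2b, node N03 of 28), seat `pub-ymgap-dag-p1` = n03-a (prover; HUMAN RULING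
D-0062), generation g4.  THEOREMS ONLY, def-free, sorry-free, standard axioms.  The CONVENTIONS OF RECORD block of the root module `Node00.Carriers` applies.

## WHAT THIS FILE IS.  The located caveat (c7) of the chair's N03 count line (R443, 2026-08-26): «the tower ∕ census index is EMPTY at `L = 3` (`4 ≤ ℓ` is a
field), INHABITED at `L = 5` (the record's witness, `D = 4`), and for odd `L ≥ 7` its inhabitation (top cubes' placement via p38's chart `ccAt`) is NOT in the
tree».  This file puts odd `L ≥ 7` IN the tree, by name over `B6KLevelFamilyWitnessOddLV1` (the odd-`L` twin of r03's `L = 5` witness): the index of record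
`KRIdx d ℓ …` (print's units `c_f = Lᵏ`) of the k-level tower block `D6OfRecord θ` is inhabited at EVERY even `ℓ ≥ 4` (odd `L ≥ 5`), every `k ≥ 2`, beyond
every census threshold, by the TOP-EMPTY two-level member (nominal top level `k` empty, sites at levels `k − 1` and `k − 2`; every cube `Placed` by
`B6CubeWindowV1.placed_of_lt`) — and by the RE-INDEXING lemmas of that file (`exists_reindexUp` ∕ `exists_reindexDown`: a nominal-`(j+1)` family with empty
top level IS a genuine `j`-level family of (2.1)–(2.4) on the same torus with `P′ ↦ L·P′`, same level function, same big blocks, same (2.2)) the LEVEL DATA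
of such members are (re-indexed copies of) those of all genuine multi-level V1 torus families at that `L` (HONEST SCOPE (1)–(3) for what this does and
does not identify).

* §1 `kRIdx_nonvacuous_oddL` — the odd-`L` twin of dag-p1's `kRIdx_nonvacuous_L5` (`Node00/CarriersB6KDischarge`); `N03_index_inhabited_oddL`,
  `N03_index_inhabited_at (θ) (hℓ : 4 ≤ θ.ℓ₆)` — the `∀ i, Hyp → M₁ ≤ M → …` of Lemma 2.1 ∕ Props. 2.2, 2.3, 2.6, 2.7 ∕ Cor. 2.8 at `D6OfRecord θ` are NOT
  vacuous at ANY Stage-3 parameter with `L ≥ 5` (at `L = 3` the index is empty — unchanged, SAID).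
* §2 `N03_worldOfRecord₃_exists_dim4_oddL` — Stage-3 worlds of record EXIST with `D = 4` and EVERY odd `L ≥ 3` (admissibility does not constrain `L`; the
  dossier's `L = 5` construction verbatim with `L := ℓ + 1`, `δ₀ := 2/L`); **`N03_at_record₃_inhabited_oddL (hℓ : 4 ≤ ℓ)`** — INHABITED-AT-3 AT EVERY ODD
  `L ≥ 5`: a Stage-3 world of record with `D = 4`, `L = ℓ + 1` at which the node `Dag.B6_main` holds every run (`N03_at_record₃`), the leaf
  `B6BlockParam (D6OfRecord θ)` holds OUTRIGHT (`b6BlockParam_D6OfRecord`), AND the block's index is inhabited at every `k ≥ 2` beyond every threshold — so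
  no leg of the leaf is true-by-empty-family there.

## HONEST SCOPE (numbers, not adjectives).  Non-vacuity bookkeeping; no inequality of print is claimed.  (1) WHAT IS PROVED about the odd-`L ≥ 7` members:
they exist at every `k ≥ 2` beyond every threshold, their nominal top level is EMPTY, and (F1 §1, theorems) a top-empty nominal-`k` family and a genuine
`(k−1)`-level family of (2.1)–(2.4) with `P′ ↦ L·P′` are the same level data on the same torus (same `lev`, same big blocks, same cubes, same torus (2.2)).
(2) UNITS (a remark on the index fields, not a theorem of this file): in `KIdx` the fine-lattice factor `c_f ≠ 0` is a free field and the band (2.16)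
constrains the RELATIVE weights `w(b)/(c_f/L^{n(b)})²`, so the copy of a genuine `(k−1)`-level member with `(c_f, w)` kept verbatim is again a member of the
same `KIdx d ℓ … b₀ b₁`; in `KRIdx` (`c_f = Lᵏ` pinned) the copy carries `c_f = L·c_f′`, `w = L²·w′` (same relative weights).  (3) NOT PROVED ANYWHERE IN THE
TREE: that the operators `GE ∕ …` of `B6GlobalChartV1.domT` for the copy coincide with (the unit-rescaled) operators of the `(k−1)`-level member — `domT`
records the nominal `k` as a field, so the identification is an unfolding exercise left undone; accordingly «the censuses are non-vacuous at odd `L ≥ 7`» means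
EXACTLY: they quantify over the (inhabited) class of top-empty nominal-`k` members, `k ≥ 2`.  (4) STILL NOT IN THE TREE: a member whose NOMINAL top level is
inhabited at odd `L ≥ 7` (it needs p38's deeper chart `B6Partition118KLevelTorusCentralAt.ccAt` carried through a twin of `B6CubeWindowV1`).  (5) At `L = 3`
the index is EMPTY (`4 ≤ ℓ` is a field) — unchanged.  N03's booking (R443) is the chair's; this file changes no statement of record.  One finite four-torus
programme at fixed ε per run — NOT ℝ⁴ ∕ infinite volume ∕ OS ∕ mass gap ∕ Clay.
HONEST FRAMING: statement-level skeleton of published theorems with citation tags; proofs where landed; nothing here is a claim about the Yang–Mills mass gap.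
-/

noncomputable section

namespace Literature.MathematicalPhysics.QuantumFieldTheory.Balaban1983to89.Node00

open DagBinding
open B4Reflection242 (boxDom)
open B6MultiLevelBoxOperator (N0)
open B6KLevelCensusIndexV1 (KIdx kGeoG)
open B6KLevelFamilyWitnessOddLV1 (kIdx_nonvacuous_oddL)

/-! ## §1. The index of record at every odd `L ≥ 5` -/

/-- **THE INDEX OF RECORD IS INHABITED AT EVERY ODD `L ≥ 5`** (`ℓ ≥ 4` even): for every `k ≥ 2`, every real threshold `M₂` and natural `N₁`, every band
`0 < b₀ ≤ b₁`, a member of `KRIdx d ℓ …` (print's units `c_f = Lᵏ`) with nominal index `k`, `M₂ ≤ M = L·M_h`, `N₁ + 1 ≤ R·L·M_h`, whose nominal top level is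
EMPTY (`lev ≤ k − 1`) with sites at level `k − 1` and — for `k ≥ 3` — at level `k − 2`: `B6KLevelFamilyWitnessOddLV1.kIdx_nonvacuous_oddL` at `c_f = Lᵏ`.  The
odd-`L` twin of `kRIdx_nonvacuous_L5`. [cite: Balaban1984PropagatorsII, (2.1)–(2.4) p.224 («We admit the case when some domains Ω_j are equal to T_η»), (2.16) p.225, Prop. 2.2 p.234 («M is sufficiently large»)] -/
theorem kRIdx_nonvacuous_oddL (d ℓ k : ℕ) (hd : 1 ≤ d + 1) (hL : Odd (ℓ + 1) ∧ 1 < ℓ + 1) (hℓ : 4 ≤ ℓ) (hk : 2 ≤ k) (M₂ : ℝ) (N₁ : ℕ)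
    {b₀ b₁ : ℝ} (hb₀ : 0 < b₀) (hb₁ : b₀ ≤ b₁) :
    ∃ i : KRIdx d ℓ hd hL b₀ b₁, i.1.k = k ∧ M₂ ≤ (kGeoU i.1).M ∧ N₁ + 1 ≤ i.1.R * ((ℓ + 1) * i.1.Mh) ∧
      (∀ x, i.1.D.lev x ≤ k - 1) ∧ (∃ x ∈ boxDom (N0 ℓ i.1.Mh i.1.k i.1.P'), i.1.D.lev x = k - 1) ∧
      (3 ≤ k → ∃ x ∈ boxDom (N0 ℓ i.1.Mh i.1.k i.1.P'), i.1.D.lev x = k - 2) := by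
  have hcf : (((ℓ + 1 : ℕ) : ℝ)) ^ k ≠ 0 := by positivity
  obtain ⟨i, hik, hicf, -, hM, hN, htop, hx1, hx2⟩ := kIdx_nonvacuous_oddL d ℓ k hd hL hℓ hk hcf M₂ N₁ hb₀ hb₁
  exact ⟨⟨i, by rw [hicf, hik]⟩, hik, hM, hN, htop, hx1, hx2⟩

/-- **AT EVERY ODD `L ≥ 5` THE INDEX OF THE TOWER BLOCK OF RECORD IS INHABITED BEYOND EVERY THRESHOLD** — for every `k ≥ 2`, every real `M₂` and natural
`N₁` a member with nominal index `k` (top level empty, levels `k − 1`, `k − 2` inhabited), `M₂ ≤ M = L·M_h`, `N₁ + 1 ≤ R·L·M_h`: the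
`∀ i, Hyp → M₁ ≤ M → …` of Lemma 2.1 ∕ Props. 2.2, 2.3, 2.6, 2.7 ∕ Cor. 2.8 at `D6OfRecord θ` are NOT vacuous at any `θ` with `4 ≤ θ.ℓ₆` — the odd-`L` twin of
the dossier's `N03_index_inhabited_L5`. [cite: Balaban1984PropagatorsII, (2.1)–(2.4) p.224, (2.16) p.225, Prop. 2.2 p.234 («M is sufficiently large»)] -/
theorem N03_index_inhabited_oddL (d ℓ k : ℕ) (hd : 1 ≤ d + 1) (hL : Odd (ℓ + 1) ∧ 1 < ℓ + 1) (hℓ : 4 ≤ ℓ) (hk : 2 ≤ k) (M₂ : ℝ) (N₁ : ℕ)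
    {b₀ b₁ : ℝ} (hb₀ : 0 < b₀) (hb₁ : b₀ ≤ b₁) :
    ∃ i : KRIdx d ℓ hd hL b₀ b₁, i.1.k = k ∧ (kGeoU i.1).Hyp21_22 ∧ M₂ ≤ (kGeoU i.1).M ∧ N₁ + 1 ≤ i.1.R * ((ℓ + 1) * i.1.Mh) ∧
      (∀ x, i.1.D.lev x ≤ k - 1) := by
  obtain ⟨i, hk', hM, hN, htop, -, -⟩ := kRIdx_nonvacuous_oddL d ℓ k hd hL hℓ hk M₂ N₁ hb₀ hb₁
  exact ⟨i, hk', trivial, hM, hN, htop⟩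

/-- **… AT EVERY STAGE-3 PARAMETER `θ` WITH `L ≥ 5`** (`4 ≤ θ.ℓ₆`), on the block of record itself (`(D6OfRecord θ).I = KRIdx θ.d₆ θ.ℓ₆ …` and
`(D6OfRecord θ).geo i = kGeoU i.1`, both `rfl` — the dossier's `N03_block_index`). [cite: Balaban1984PropagatorsII, (2.1)–(2.4) p.224, (2.16) p.225, Prop. 2.2 p.234] -/
theorem N03_index_inhabited_at (θ : Stage3Params) (hℓ : 4 ≤ θ.ℓ₆) (k : ℕ) (hk : 2 ≤ k) (M₂ : ℝ) (N₁ : ℕ) :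
    ∃ i : (D6OfRecord θ).I, i.1.k = k ∧ ((D6OfRecord θ).geo i).Hyp21_22 ∧ M₂ ≤ ((D6OfRecord θ).geo i).M ∧
      N₁ + 1 ≤ i.1.R * ((θ.ℓ₆ + 1) * i.1.Mh) ∧ (∀ x, i.1.D.lev x ≤ k - 1) :=
  N03_index_inhabited_oddL θ.d₆ θ.ℓ₆ k θ.hd' θ.hL' hℓ hk M₂ N₁ θ.hb.1 θ.hb.2

/-! ## §2. Stage-3 worlds of record at every odd `L`; INHABITED-AT-3 at every odd `L ≥ 5` -/

/-- **Stage-3 worlds of record EXIST with `D = 4` and EVERY odd `L = ℓ + 1 ≥ 3`**: the admissible Stage-1 family of `Stage1Params.exists_admissible` with its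
block size set to `ℓ + 1` (admissibility does not constrain `L`), coefficient algebra `ℂ`, `d₆ = 3`, `ℓ₆ = ℓ`, band `b₀ = b₁ = 1`, rate `δ₀ = 2/L`; the un-pinned
bundles degenerate (`Node00.Satisfiable`) — the dossier's `N03_worldOfRecord₃_exists_dim4_L5` with `5 ↦ ℓ + 1`.
[cite: Balaban1984PropagatorsII, (2.1)–(2.4) p.224, (2.16) p.225 (Stage-3 parameter dictionary) — bookkeeping] -/
theorem N03_worldOfRecord₃_exists_dim4_oddL (ℓ : ℕ) (hL : Odd (ℓ + 1) ∧ 1 < ℓ + 1) :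
    ∃ (θ : Stage3Params) (w : WorldP), θ.toStage1Params.Admissible ∧ θ.D = 4 ∧ θ.L = ℓ + 1 ∧ θ.ℓ₆ = ℓ ∧ IsWorldOfRecord₃ w ∧
      ∀ P : B12.RunParams, ∃ (X : PrintedCarriersR) (Y : PrintedCarriers9X) (Z : PrintedCarriers11) (V : PrintedCarriers14R) (W : PrintedCarriers15),
        w.up P = Upstream.ofPrintedAllXPN (carriers₃ θ X) Y Z V W := by
  obtain ⟨θ, hθ, hD⟩ := Stage1Params.exists_admissible
  obtain ⟨X⟩ := nonempty_printedCarriersR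
  obtain ⟨Y⟩ := nonempty_printedCarriers9X
  obtain ⟨Z⟩ := nonempty_printedCarriers11
  obtain ⟨V⟩ := nonempty_printedCarriers14R
  obtain ⟨W⟩ := nonempty_printedCarriers15
  obtain ⟨w⟩ := nonempty_worldP
  let θ₃ : Stage3Params :=
    { θ with
      L := ℓ + 1, hL := hL
      𝔸 := ℂ, d₆ := 3, ℓ₆ := ℓ, hd₆ := by omega, hℓ₆ := rfl, b₀ := 1, b₁ := 1
      hb := ⟨one_pos, le_rfl⟩, δ₀ := 2 / ((ℓ : ℝ) + 1), hδ₀ := ⟨by positivity, le_rfl⟩ }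
  have hθ₃ : θ₃.toStage1Params.Admissible := hθ
  refine ⟨θ₃, WorldP.withUp w fun _ => Upstream.ofPrintedAllXPN (carriers₃ θ₃ X) Y Z V W, hθ₃, hD, rfl, rfl,
    isWorldOfRecord₃_of_up θ₃ hθ₃ X Y Z V W _ rfl, fun P => ⟨X, Y, Z, V, W, rfl⟩⟩

/-- **INHABITED-AT-3 AT EVERY ODD `L ≥ 5`** (director LINE №22 rider shape, odd-`L` form): for every even `ℓ ≥ 4` there are a Stage-3 parameter `θ` with `D = 4`,
`L = ℓ + 1` and a Stage-3 world of record `w` over it (every run's upstream bundle is `carriers₃ θ X` for some printed carriers) such that: the node `Dag.B6_main`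
holds at `w` every run (`N03_at_record₃`, hypothesis-free); the leaf `B6BlockParam (D6OfRecord θ)` holds OUTRIGHT (`b6BlockParam_D6OfRecord`); AND the block's
index is inhabited at every `k ≥ 2` beyond every threshold `M₂`, `N₁` (§1) — so at this world no leg of the leaf is true-by-empty-family.  The `L = 5` record
witness (`N03_at_record₃_inhabited` + `N03_index_inhabited_L5`) is the case `ℓ = 4`.
[cite: Balaban1984PropagatorsII, (2.1)–(2.4) p.224, (2.16) p.225, Prop. 2.2 p.234 («M is sufficiently large») — parameter dictionary; bookkeeping witness] -/
theorem N03_at_record₃_inhabited_oddL (ℓ : ℕ) (hL : Odd (ℓ + 1) ∧ 1 < ℓ + 1) (hℓ : 4 ≤ ℓ) :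
    ∃ (θ : Stage3Params) (w : WorldP), θ.toStage1Params.Admissible ∧ θ.D = 4 ∧ θ.L = ℓ + 1 ∧ θ.ℓ₆ = ℓ ∧ IsWorldOfRecord₃ w ∧
      (∀ P : B12.RunParams, ∃ (X : PrintedCarriersR) (Y : PrintedCarriers9X) (Z : PrintedCarriers11) (V : PrintedCarriers14R) (W : PrintedCarriers15),
        w.up P = Upstream.ofPrintedAllXPN (carriers₃ θ X) Y Z V W) ∧
      (∀ P : B12.RunParams, Dag.B6_main (leavesP w P)) ∧ B6BlockParam (D6OfRecord θ) ∧
      ∀ k : ℕ, 2 ≤ k → ∀ (M₂ : ℝ) (N₁ : ℕ), ∃ i : (D6OfRecord θ).I, i.1.k = k ∧ ((D6OfRecord θ).geo i).Hyp21_22 ∧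
        M₂ ≤ ((D6OfRecord θ).geo i).M ∧ N₁ + 1 ≤ i.1.R * ((ℓ + 1) * i.1.Mh) ∧ (∀ x, i.1.D.lev x ≤ k - 1) := by
  obtain ⟨θ, w, hθ, hD, hLθ, hℓθ, hw, hup⟩ := N03_worldOfRecord₃_exists_dim4_oddL ℓ hL
  refine ⟨θ, w, hθ, hD, hLθ, hℓθ, hw, hup, N03_at_record₃ w hw, b6BlockParam_D6OfRecord θ hθ, fun k hk M₂ N₁ => ?_⟩
  subst hℓθ
  exact N03_index_inhabited_at θ hℓ k hk M₂ N₁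

end Literature.MathematicalPhysics.QuantumFieldTheory.Balaban1983to89.Node00

end
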